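import Literature.NumberTheory.ModularForms.DedekindSumRademacherPhi
import Literature.NumberTheory.EllipticCurves.PAdicLFunction
import HarnessLib

/-!
# Route `EisensteinDepletionAtTwo`, crux E1M `DepletedLambdaLawAtTwoMod` (item stmt-BirchSwinnertonDyer-20341),
# line `star` — DEFINITIONS of the Eisenstein side (the objects the line posits)

Cell `bsd-rank2` (HOME run/shared/lean/pub/bsd-rank2/), seat `bsd-rank2-eng-2` GEN 8. DEFINITIONS ONLY (no theorem
beyond `rfl`-unfoldings, no named fact, no `sorry`). HONEST FRAMING: typed vocabulary for the Eisenstein half (★-EisNorm)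
and the symbol half (★-SymbC) of the research identity (★) of line `star`; nothing here proves anything about `λ(L₂(E))`,
nothing reads an analytic rank, BSD is not proved by any of this (PARTITION D-0054: none — r_an ≥ 2 axis S0, door T-r3₂).

These are VERBATIM the local definitions of the registered skeleton `Cruxes/DepletedLambdaLawAtTwoMod/Lines/star.lean`
v2.1 (planner bsd-rank2-p2 GEN 19 sketch v1.5 / lead bsd-rank2-star-p1), with one change: Rademacher's `Φ` and the
Dedekind sum are the LITERATURE declarations `Literature.NumberTheory.ModularForms.rademacherPhi` / `dedekindSum`
(D2, `Literature/NumberTheory/ModularForms/DedekindSumRademacherPhi.lean`) instead of local copies, so that the cusp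
formula `Literature.NumberTheory.ModularForms.sum_rademacherPhi_bezout_conj` (p552106) applies by name. The skeleton's
local `saw` is `dedekindSaw` up to `x.den = 1 ↔ Int.fract x = 0` (the only non-`rfl` bridge).

* `gammaEntries N b d` — the Bézout matrix `γ_{b,d} = (x, b; −N y, d) ∈ Γ₀(N)` of the cusp `b/d`, `d x + b N y = 1`
  (`x = Int.gcdA d (bN)`, `y = Int.gcdB d (bN)`). [cite: Stevens1982, §2.5 eq. (2.5.3) (PDF p. 38)]
* `localStabCoeff`, `stabCoeff` — the coefficients `c_t`, `t ∣ N`, of the stabilised / depleted weight-2 Eisenstein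
  series `∏_ℓ L_ℓ(V_ℓ)·E₂`: `L_ℓ = 1 − (β_ℓ/ℓ)V_ℓ` at `ℓ ∥ N` (U-eigen datum `β_ℓ ∈ {1, ℓ}`), full depletion
  `L_ℓ = 1 − ((1+ℓ)/ℓ)V_ℓ + (1/ℓ)V_ℓ²` at `ℓ² ∥ N`. [cite: Stevens1982, §2.4 and §5.4 (PDF pp. 35–38, 72–74)]
  [cite: GreenbergVatsal2000, §3 (28) (Σ₀-depleted Eisenstein series)]
* `stabEisensteinPeriod N β` — its period function `(a b; c d) ↦ ∑_{t ∣ N} c_t·Φ(a, tb; c/t, d)` on `Γ₀(N)`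
  (`Φ` of the level-`t` conjugate is the period function of `E₂(tz)`). [cite: RademacherGrosswald1972, Ch. 4 A, eq. (59)]
  [cite: Stevens1982, §2.5 (PDF p. 38)]
* `IsAdmissibleStabData N β` — exponents `≤ 2`, `β_ℓ ∈ {1, ℓ}` at `ℓ ∥ N`, and holomorphy at both cusps of the
  2-power tower (`∑ c_t = 0`, `∑ c_t t = 0`; automatic when some `ℓ² ∥ N`).
* `stabEisCuspDiff N β m a = φ_β(γ_{a,2^m}) − φ_β(γ_{1,2^m})` — cusp differences normalised at `a = 1`.
* `plusCuspDiff f m a = [a/2^m]⁺_f − [1/2^m]⁺_f` — the curve side (rational plus symbols).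
  [cite: MazurTateTeitelbaum1986Invent, §I.10 (10.1)]
* `InC m a` — the index set `C = {(m,a) : m ≥ 3, a ≡ 1 (4), 1 < a < 2^m}`.
* `eisNormMeasure N β g'` — the `C`-normalised Eisenstein measure
  `ν(a + 2ⁿℤ₂) = (v(n,a) − v(n−1, a mod 2ⁿ⁻¹))/g'` on the `η = +1` classes of level `n ≥ 4`, `0` elsewhere
  (the `α = 1` Mazur–Tate–Teitelbaum combination of `v = stabEisCuspDiff N β`). [cite: MazurTateTeitelbaum1986Invent, §I.10–I.11]

References: G. Stevens, *Arithmetic on Modular Curves*, Progress in Math. 20 (1982), §2.4–2.5, §5.4 [Stevens1982];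
H. Rademacher, E. Grosswald, *Dedekind Sums*, Carus 16 (1972), Ch. 4 A [RademacherGrosswald1972];
B. Mazur, J. Tate, J. Teitelbaum, Invent. Math. 84 (1986), §I.10–I.13 [MazurTateTeitelbaum1986Invent];
R. Greenberg, V. Vatsal, Invent. Math. 142 (2000), §3 [GreenbergVatsal2000].
-/

set_option linter.dupNamespace false
set_option autoImplicit false

noncomputable section

open Literature.NumberTheory.ModularForms Literature.NumberTheory.EllipticCurves
  Literature.NumberTheory.EllipticCurves.ModularForms

namespace Summit.BirchSwinnertonDyer.BirchSwinnertonDyer.Theorems.DepletionAtTwo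

/-- **The Bézout matrix of the cusp `b/d` at level `N`**: `γ_{b,d} = (x, b; −N y, d)` with `x = gcdA(d, bN)`,
`y = gcdB(d, bN)`, so that `d x + b N y = gcd(d, bN)` (`= 1` for `gcd(d, bN) = 1`, then `γ_{b,d} ∈ Γ₀(N)` and
`γ_{b,d}·0 = b/d`); returned as the quadruple of entries `(a, b, c, d)`.
[cite: Stevens1982, §2.5 eq. (2.5.3) (PDF p. 38)] -/
def gammaEntries (N : ℕ) (b d : ℤ) : ℤ × ℤ × ℤ × ℤ :=
  (Int.gcdA d (b * N), b, -(N : ℤ) * Int.gcdB d (b * N), d)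

/-- **Local stabilisation coefficient at `ℓ`**: the coefficient of `V_ℓ^j` in `L_ℓ(V_ℓ)`, where
`L_ℓ = 1 − (β_ℓ/ℓ)V_ℓ` if `ℓ ∥ N`, `L_ℓ = 1 − ((1+ℓ)/ℓ)V_ℓ + (1/ℓ)V_ℓ²` if `ℓ² ∥ N` (full depletion), `L_ℓ = 1` otherwise.
[cite: Stevens1982, §2.4 (PDF pp. 35–37)] [cite: GreenbergVatsal2000, §3 (28)] -/
def localStabCoeff (N : ℕ) (β : ℕ → ℕ) (ℓ j : ℕ) : ℚ :=
  if N.factorization ℓ = 1 then (if j = 0 then 1 else if j = 1 then -(β ℓ : ℚ) / ℓ else 0)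
  else if N.factorization ℓ = 2 then
    (if j = 0 then 1 else if j = 1 then -((1 : ℚ) + ℓ) / ℓ else if j = 2 then (1 : ℚ) / ℓ else 0)
  else (if j = 0 then 1 else 0)

/-- **Global coefficient `c_t` of `Φ(γ_t)`, `t ∣ N`**: the product over the primes of `N` of the local coefficients
at the exponents of `t`. [cite: Stevens1982, §2.4 (PDF pp. 35–37)] -/
def stabCoeff (N : ℕ) (β : ℕ → ℕ) (t : ℕ) : ℚ :=
  ∏ ℓ ∈ N.primeFactors, localStabCoeff N β ℓ (t.factorization ℓ)

/-- **Period function of the stabilised / depleted weight-2 Eisenstein series `∏_ℓ L_ℓ(V_ℓ)·E₂` at level `N`**: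
`(a b; c d) ↦ ∑_{t ∣ N} c_t · Φ(a, tb; c/t, d)` (Rademacher's `Φ` of the Literature, at the level-`t` conjugate matrix).
[cite: RademacherGrosswald1972, Ch. 4 A, eq. (59)] [cite: Stevens1982, §2.5 (PDF p. 38)] -/
def stabEisensteinPeriod (N : ℕ) (β : ℕ → ℕ) (a b c d : ℤ) : ℚ :=
  ∑ t ∈ N.divisors, stabCoeff N β t * rademacherPhi a (t * b) (c / t) d

/-- **Admissible stabilisation data at level `N`**: all exponents `≤ 2`, `β_ℓ ∈ {1, ℓ}` at the primes `ℓ ∥ N`, and the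
product is holomorphic and not all-critical — some `ℓ² ∥ N`, or some `β_ℓ = ℓ` AND some `β_ℓ = 1`
(so that `∑_t c_t = ∏_ℓ L_ℓ(1) = 0` and `∑_t c_t t = 0`). [cite: Stevens1982, §2.4–2.5 (PDF pp. 35–38)] -/
def IsAdmissibleStabData (N : ℕ) (β : ℕ → ℕ) : Prop :=
  (∀ ℓ ∈ N.primeFactors, N.factorization ℓ ≤ 2) ∧
  (∀ ℓ ∈ N.primeFactors, N.factorization ℓ = 1 → (β ℓ = 1 ∨ β ℓ = ℓ)) ∧
  ((∃ ℓ ∈ N.primeFactors, N.factorization ℓ = 2) ∨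
    ((∃ ℓ ∈ N.primeFactors, β ℓ = ℓ) ∧ (∃ ℓ ∈ N.primeFactors, β ℓ = 1)))

/-- **Eisenstein side on the 2-power cusps, normalised at `a = 1`**: `v(m, a) = φ_β(γ_{a,2^m}) − φ_β(γ_{1,2^m})`.
[cite: Stevens1982, §2.5 (PDF p. 38)] [cite: MazurTateTeitelbaum1986Invent, §I.10] -/
def stabEisCuspDiff (N : ℕ) (β : ℕ → ℕ) (m : ℕ) (a : ℤ) : ℚ :=
  let e := gammaEntries N a (2 ^ m : ℕ)
  let e₁ := gammaEntries N 1 (2 ^ m : ℕ)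
  stabEisensteinPeriod N β e.1 e.2.1 e.2.2.1 e.2.2.2 - stabEisensteinPeriod N β e₁.1 e₁.2.1 e₁.2.2.1 e₁.2.2.2

/-- **Curve side on the 2-power cusps, normalised at `a = 1`**: `u(m, a) = [a/2^m]⁺_f − [1/2^m]⁺_f`
(rational plus modular symbols of the cusp form `f`). [cite: MazurTateTeitelbaum1986Invent, §I.10 (10.1)] -/
def plusCuspDiff {N : ℕ} (f : CuspForm (CongruenceSubgroup.Gamma0 N) 2) (m : ℕ) (a : ℤ) : ℚ :=
  ratPlusSymbol f ((a : ℚ) / (2 ^ m : ℕ)) - ratPlusSymbol f (1 / (2 ^ m : ℕ))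

/-- **The index set `C`**: `(m, a) ∈ C ⟺ m ≥ 3, a ≡ 1 (mod 4), 1 < a < 2^m` (the `η = +1` unit classes of
level `m`, the class of `1` removed). [cite: MazurTateTeitelbaum1986Invent, §I.11 (the classes η·γ^s)] -/
def InC (m : ℕ) (a : ℤ) : Prop := 3 ≤ m ∧ a % 4 = 1 ∧ 1 < a ∧ a < 2 ^ m

/-- **The `C`-normalised Eisenstein measure in units of `g'`**: on the `η = +1` unit classes `a ≡ 1 (mod 4)` of
level `n ≥ 4`, `ν(a + 2ⁿℤ₂) = (v(n, a) − v(n−1, a mod 2ⁿ⁻¹))/g'` with `v = stabEisCuspDiff N β` — the `α = 1`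
Mazur–Tate–Teitelbaum combination `[a/2ⁿ] − [a/2ⁿ⁻¹]` of the Eisenstein cusp values with the level constants
removed —; `0` on all other classes and levels. [cite: MazurTateTeitelbaum1986Invent, §I.10 (10.1) and §I.11] -/
def eisNormMeasure (N : ℕ) (β : ℕ → ℕ) (g' : ℚ) : (n : ℕ) → ZMod (2 ^ n) → ℚ_[2] := fun n a ↦
  if 4 ≤ n ∧ a.val % 4 = 1 then
    (((stabEisCuspDiff N β n (a.val : ℤ) - stabEisCuspDiff N β (n - 1) ((a.val % 2 ^ (n - 1) : ℕ) : ℤ)) / g' : ℚ) :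
      ℚ_[2])
  else 0

/-! ## Unfolding lemmas (`rfl`) -/

/-- Entries of the Bézout matrix (unfolding). [cite: Stevens1982, §2.5 eq. (2.5.3) (PDF p. 38) (unfolding)] -/
theorem gammaEntries_eq (N : ℕ) (b d : ℤ) :
    gammaEntries N b d = (Int.gcdA d (b * N), b, -(N : ℤ) * Int.gcdB d (b * N), d) := rfl

/-- `v(m, a)` unfolded to the two period values on the Bézout matrices of `a/2^m` and `1/2^m`.
[cite: Stevens1982, §2.5 (PDF p. 38) (unfolding)] -/
theorem stabEisCuspDiff_eq (N : ℕ) (β : ℕ → ℕ) (m : ℕ) (a : ℤ) :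
    stabEisCuspDiff N β m a =
      stabEisensteinPeriod N β (Int.gcdA ((2 ^ m : ℕ) : ℤ) (a * N)) a
          (-(N : ℤ) * Int.gcdB ((2 ^ m : ℕ) : ℤ) (a * N)) ((2 ^ m : ℕ) : ℤ) -
        stabEisensteinPeriod N β (Int.gcdA ((2 ^ m : ℕ) : ℤ) (1 * N)) 1
          (-(N : ℤ) * Int.gcdB ((2 ^ m : ℕ) : ℤ) (1 * N)) ((2 ^ m : ℕ) : ℤ) := rfl

/-- The period function unfolded as the divisor sum. [cite: RademacherGrosswald1972, Ch. 4 A, eq. (59) (unfolding)] -/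
theorem stabEisensteinPeriod_eq (N : ℕ) (β : ℕ → ℕ) (a b c d : ℤ) :
    stabEisensteinPeriod N β a b c d = ∑ t ∈ N.divisors, stabCoeff N β t * rademacherPhi a (t * b) (c / t) d := rfl

/-- `v(m, 1) = 0` (the normalisation). [cite: MazurTateTeitelbaum1986Invent, §I.10 (normalisation)] -/
theorem stabEisCuspDiff_one (N : ℕ) (β : ℕ → ℕ) (m : ℕ) : stabEisCuspDiff N β m 1 = 0 := by
  simp only [stabEisCuspDiff, sub_self]

/-- The `C`-normalised measure off the `η = +1` classes of level `≥ 4` is `0` (unfolding).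
[cite: MazurTateTeitelbaum1986Invent, §I.11 (unfolding)] -/
theorem eisNormMeasure_of_not (N : ℕ) (β : ℕ → ℕ) (g' : ℚ) {n : ℕ} {a : ZMod (2 ^ n)}
    (h : ¬ (4 ≤ n ∧ a.val % 4 = 1)) : eisNormMeasure N β g' n a = 0 := by
  simp only [eisNormMeasure, if_neg h]

/-- The `C`-normalised measure on an `η = +1` class of level `≥ 4` (unfolding).
[cite: MazurTateTeitelbaum1986Invent, §I.10 (10.1) (unfolding)] -/
theorem eisNormMeasure_of (N : ℕ) (β : ℕ → ℕ) (g' : ℚ) {n : ℕ} {a : ZMod (2 ^ n)}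
    (h : 4 ≤ n ∧ a.val % 4 = 1) :
    eisNormMeasure N β g' n a =
      (((stabEisCuspDiff N β n (a.val : ℤ) - stabEisCuspDiff N β (n - 1) ((a.val % 2 ^ (n - 1) : ℕ) : ℤ)) / g' :
        ℚ) : ℚ_[2]) := by
  simp only [eisNormMeasure, if_pos h]

end Summit.BirchSwinnertonDyer.BirchSwinnertonDyer.Theorems.DepletionAtTwo

end
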